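import Summits.CriticalPhenomena.PercolationContinuityZ3.Theorems.PercShatteringRaceNearLinearTwoClusterDecayStubCritPairConnLower
import Summits.CriticalPhenomena.PercolationContinuityZ3.Theorems.PercShatteringRaceNearLinearTwoClusterDecayStubCritAspectOfTwoArm
import Summits.CriticalPhenomena.PercolationContinuityZ3.Theorems.PercShatteringRaceNearLinearTwoClusterDecayRelayBootstrap
import Summits.CriticalPhenomena.PercolationContinuityZ3.Theorems.NearLinearTwoClusterDecay.Negative.Structure
import HarnessLib

/-!
# Crux `PercShatteringRace.NearLinearTwoClusterDecay` (stmt-CriticalPhenomena-5785) — certificate U₁: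
# the UNCONDITIONAL layer for bond `ℤ³` (Cerf 2015 Theorems 1.1/1.2 at `p_c`, world-free)

Helper file of the line `pair-decay-long-arms-dense` (lead c6, skeleton rev L7b-c6 § Unconditional frontier); lands with
`--supports stmt-CriticalPhenomena-5785`.  It composes the two landed frontier stubs

* W1 `Theorems.stub_critPairConnLower` — `P_{p_c}(a ↔ b inside Λ_{2n}) ≥ c n^{-12}` on `Λ_n²` (Duminil-Copin–Tassion
  `φ_{p_c}(Λ_m) ≥ 1` + Cerf Lemma 6.1 chaining),
* W3 `Theorems.stub_critAspectOfTwoArm` — `TwoArm κ ⇒` the crux event of `(Λ_n, Λ_{⌈n^A⌉})` tends to `0` whenever `A > 1`,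
  `κA > 24` (Cerf Lemma 7.1 + Cor 7.2 divided by W1),

with the landed `NearLinearTwoClusterDecay.RelayBootstrap.twoArm_of_lt_half` (`TwoArm κ` for every `κ < 1/2`, AKN) into:

* `critAtExponent_of_gt_48` — **bond Cerf 2015 Theorem 1.2 at `p_c(ℤ³)`, UNCONDITIONAL**: `Negative.AtExponent A` for every
  `A > 48`, i.e. the crux family holds at every aspect exponent above `48` with NO hypothesis on the world (`θ(p_c) = 0` or
  `> 0`).  Before this file the tree had: `1 ≤ α*` (`Negative.not_atExponent_of_le_one`), aspect `48` only in the jump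
  world (`twoClusterDecay_aspect48_of_theta_pos`, p139331), and the print value `α* ≤ 42.17` for SITE percolation
  (`Literature.Probability.Percolation.Cerf2015_thm_1_2_holds`); the crux asserts `α* ≤ 7/6`
  (`Negative.nearLinearTwoClusterDecay_iff`), the sibling crux stmt-0859 asserts `α* ≤ 1` (`Negative.critBoxTwoArmsDecay_iff`);
* (sequel `…CritFrontierStrict.lean`, once W2 `stub_critTwoArmImproved` — bond Cerf Thm 1.1 at `p_c`, `∃ κ > 1/2, TwoArm κ` —
  lands: the threshold is STRICTLY below `48`, and the endpoint `A = 48` follows by monotonicity);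
* `critBoxTwoArmsDecay_above_48` — the same fact in the vocabulary of the sibling crux `PercFiniteBoxLRO.CritBoxTwoArmsDecay`
  (stmt-CriticalPhenomena-0859): its conclusion holds for every `α > 48`;
* `nearLinearTwoClusterDecay_iff_exists_le`, `atExponent_status` — bookkeeping: the crux is EQUIVALENT to "`AtExponent A` for some
  `A ∈ [1, 7/6]`"; decay fails at every `A ≤ 1` and holds at every `A > 48`; recorded so that planners can file the residue 1:1.

## References

* R. Cerf, *A lower bound on the two-arms exponent for critical percolation on the lattice*, Ann. Probab. 43 (2015)
  2458–2480, arXiv:1306.3105: Thm 1.1, Thm 1.2, Lemma 6.1, Lemma 7.1, Cor 7.2–7.3 [Cerf2015].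
* M. Aizenman, H. Kesten, C. M. Newman, Comm. Math. Phys. 111 (1987) 505–531 [AizenmanKestenNewmanCMP1987].
* H. Duminil-Copin, V. Tassion, Enseign. Math. 62 (2016) 199–206, Thm 1.1 [DuminilCopinTassionEM2016].
-/

noncomputable section

namespace Summit.CriticalPhenomena.PercolationContinuityZ3.Theorems

namespace NearLinearTwoClusterDecay.CritFrontier

open MeasureTheory Filter Topology
open Literature.Probability.LatticeModels Literature.Probability.Percolation
open Summit.CriticalPhenomena.PercolationContinuityZ3.Theorems.NearLinearTwoClusterDecay.Negative

/-- **Bond Cerf 2015 Theorem 1.2 at `p_c(ℤ³)`, UNCONDITIONAL.** For every aspect exponent `A > 48` the crux family holds: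
`P_{p_c}`(two sites of `Λ_n` joined inside `Λ_{⌈n^A⌉}` to its inner vertex boundary but not to each other) `→ 0`.
No hypothesis on `θ(p_c)`.  Proof: W3 at `κ = (1/2 + 24/A)/2 < 1/2` (so `κA = A/4 + 12 > 24`), with W1 and the AKN
bound `twoArm_of_lt_half`. [cite: Cerf2015, Thm 1.2 and Cor 7.3] -/
theorem critAtExponent_of_gt_48 {A : ℝ} (hA : 48 < A) : NearLinearTwoClusterDecay.Negative.AtExponent A := by
  have hA0 : 0 < A := by linarith
  set κ : ℝ := (1 / 2 + 24 / A) / 2 with hκ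
  have h24A : 24 / A < 1 / 2 := by rw [div_lt_iff₀ hA0]; linarith
  have hκlt : κ < 1 / 2 := by rw [hκ]; linarith
  have hκ0 : 0 < κ := by rw [hκ]; positivity
  have hκA : 24 < κ * A := by
    have : κ * A = A / 4 + 12 := by rw [hκ]; field_simp; ring
    rw [this]; linarith
  exact stub_critAspectOfTwoArm stub_critPairConnLower κ hκ0 (RelayBootstrap.twoArm_of_lt_half hκlt) A
    (by linarith) hκA

/-- **The sibling crux above `48`**: the conclusion of `PercFiniteBoxLRO.CritBoxTwoArmsDecay` (stmt-CriticalPhenomena-0859,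
literally `∀ α > 1, AtExponent α`) holds for every `α > 48`, unconditionally. [cite: Cerf2015, Thm 1.2] -/
theorem critBoxTwoArmsDecay_above_48 :
    ∀ α : ℝ, 48 < α → Filter.Tendsto (fun n : ℕ =>
      (bondPercolation (zdGraph 3) (criticalProbI 3)).real
        {ω | ∃ x ∈ box 3 n, ∃ x' ∈ box 3 n, ∃ y ∈ innerBoundary (zdGraph 3) (box 3 ⌈(n : ℝ) ^ α⌉₊),
          ∃ y' ∈ innerBoundary (zdGraph 3) (box 3 ⌈(n : ℝ) ^ α⌉₊),
            ω ∈ openConnIn ↑(box 3 ⌈(n : ℝ) ^ α⌉₊) x y ∧ ω ∈ openConnIn ↑(box 3 ⌈(n : ℝ) ^ α⌉₊) x' y' ∧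
              ω ∉ openConnIn ↑(box 3 ⌈(n : ℝ) ^ α⌉₊) x x'}) Filter.atTop (nhds 0) :=
  fun _ hα => critAtExponent_of_gt_48 hα

/-- **What is left of the crux is pure aspect reduction.** `{A ≥ 1 | AtExponent A}` is an up-set
(`Negative.atExponent_mono`) containing `[48, ∞)` (this file) and missing `(−∞, 1]`
(`Negative.not_atExponent_of_le_one`); the crux `U(1/6) = AtExponent (7/6)` is therefore equivalent to
"`AtExponent A` for some `A ∈ [1, 7/6]`". [folklore] -/
theorem nearLinearTwoClusterDecay_iff_exists_le :
    Theses.PercShatteringRace.NearLinearTwoClusterDecay ↔ ∃ A : ℝ, 1 ≤ A ∧ A ≤ (7 : ℝ) / 6 ∧ AtExponent A := by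
  constructor
  · exact fun h => ⟨(7 : ℝ) / 6, by norm_num, le_rfl, (nearLinearTwoClusterDecay_iff).1 h⟩
  · rintro ⟨A, h1, hA, h⟩
    exact nearLinearTwoClusterDecay_of_atExponent h1 hA h

/-- **Status line of the crux family after this file** (for the planner): decay FAILS at every exponent `≤ 1`, HOLDS at
every exponent `> 48`, unconditionally; the crux sits at `7/6`. [folklore] -/
theorem atExponent_status :
    (∀ A : ℝ, A ≤ 1 → ¬ AtExponent A) ∧ (∀ A : ℝ, 48 < A → AtExponent A) ∧
    (Theses.PercShatteringRace.NearLinearTwoClusterDecay ↔ AtExponent ((7 : ℝ) / 6)) :=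
  ⟨fun _ hA => not_atExponent_of_le_one hA, fun _ hA => critAtExponent_of_gt_48 hA, nearLinearTwoClusterDecay_iff⟩

end NearLinearTwoClusterDecay.CritFrontier

end Summit.CriticalPhenomena.PercolationContinuityZ3.Theorems

end
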